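import Literature.Topology.FourManifolds.TubePacing
import Mathlib.Analysis.InnerProductSpace.Calculus
import Mathlib.Analysis.Calculus.ContDiff.Basic
import HarnessLib

/-!
# Vertex conical shears: straightening the edges at a vertex on an annulus

Topic `Literature/Topology/FourManifolds`; Euclidean device for the vertex stage of the smoothing of
PD homeomorphisms in dimension `4` (Munkres, Ann. of Math. 72 (1960), §5; the chart in which a vertex
stage reads the edge tubes must make those edges STRAIGHT on the reading annulus, so that the
black-box untwist zones of the edges are read through a linear change of coordinates only).  Given
finitely many smooth curves `γ i` through the origin with unit tangents `v i` (pairwise separated in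
angle), a radius `R` and an angular width parameter `θ₀`, the **vertex shear** is

  `vertexShear γ v R θ₀ z = z + Σ i, shearWeight v R θ₀ i z • shearDisp γ v i z`,

`shearDisp γ v i z = γ i ⟪v i, z⟫ − ⟪v i, z⟫ • v i` (the displacement of the curve from its tangent
line at the axial position of `z`) and `shearWeight` the product of a radial plateau cutoff (one on
`[R/16, 2R]`, zero off `(R/32, 3R)`) in the axial variable `⟪v i, z⟫` with an angular cutoff (one
inside the cone of slope `θ₀` around `v i`, zero outside slope `2θ₀`).  We prove: it maps the tangent
segments to the curves, `vertexShear … (s • v i) = γ i s` for `s ∈ [R/16, 2R]` when the cones are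
disjoint (`vertexShear_apply_axis`); it is the identity near the origin (`vertexShear_eq_self_of_norm_le`)
and wherever no weight is active; and it is `C^∞` (`contDiff_vertexShear`).  The derivative bound
`‖D(vertexShear) − I‖ ≲ κ R` and the ensuing global invertibility are treated in the sequel.
Definitions are explicit functions; no named facts.

## References

* J. R. Munkres, *Obstructions to the smoothing of piecewise-differentiable homeomorphisms*, Ann.
  of Math. (2) 72 (1960), 521–554, §5. [Munkres1960]
-/

noncomputable section

open Set Function Metric Filter Finset
open scoped Topology ContDiff RealInnerProductSpace BigOperators

namespace Literature.Topology.FourManifolds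

variable {H : Type*} [NormedAddCommGroup H] [InnerProductSpace ℝ H]
variable {m : ℕ}

/-! ### The pieces -/

/-- The axial coordinate `⟪v i, z⟫` along the `i`-th tangent direction. [folklore] -/
def shearAxial (v : Fin m → H) (i : Fin m) (z : H) : ℝ := ⟪v i, z⟫

/-- The transverse part `z − ⟪v i, z⟫ • v i`. [folklore] -/
def shearTrans (v : Fin m → H) (i : Fin m) (z : H) : H := z - shearAxial v i z • v i

/-- **The shear displacement** of the `i`-th curve from its tangent line, read at the axial position
of `z`: `γ i ⟪v i, z⟫ − ⟪v i, z⟫ • v i`. [folklore] -/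
def shearDisp (γ : Fin m → ℝ → H) (v : Fin m → H) (i : Fin m) (z : H) : H :=
  γ i (shearAxial v i z) - shearAxial v i z • v i

/-- The radial plateau: `1` on `[R/16, 2R]`, `0` off `(R/32, 3R)`. [folklore] -/
def shearRadial (R s : ℝ) : ℝ := rampCutoff (R / 32) (R / 16) s * (1 - rampCutoff (2 * R) (3 * R) s)

/-- The angular cutoff in the squared slope `ρ = ‖w‖²/s²`: `1` for `ρ ≤ θ₀²`, `0` for `ρ ≥ 4 θ₀²`.
[folklore] -/
def shearAngular (θ₀ ρ : ℝ) : ℝ := 1 - rampCutoff (θ₀ ^ 2) (4 * θ₀ ^ 2) ρ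

/-- **The shear weight** of the `i`-th cone: radial plateau in the axial variable times angular
cutoff in the squared slope of the transverse part. [folklore] -/
def shearWeight (v : Fin m → H) (R θ₀ : ℝ) (i : Fin m) (z : H) : ℝ :=
  shearRadial R (shearAxial v i z) *
    shearAngular θ₀ (‖shearTrans v i z‖ ^ 2 / shearAxial v i z ^ 2)

/-- **The vertex shear** `z ↦ z + Σ i, weight i z • displacement i z`. [folklore] -/
def vertexShear (γ : Fin m → ℝ → H) (v : Fin m → H) (R θ₀ : ℝ) (z : H) : H :=
  z + ∑ i, shearWeight v R θ₀ i z • shearDisp γ v i z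

variable {γ : Fin m → ℝ → H} {v : Fin m → H} {R θ₀ : ℝ}

/-! ### Plateau values of the cutoffs -/

/-- [folklore] -/
theorem shearRadial_eq_one (hR : 0 < R) {s : ℝ} (h₁ : R / 16 ≤ s) (h₂ : s ≤ 2 * R) : shearRadial R s = 1 := by
  rw [shearRadial, rampCutoff_of_ge (by linarith) h₁, rampCutoff_of_le (by linarith) h₂]; ring

/-- [folklore] -/
theorem shearRadial_eq_zero_of_le (hR : 0 < R) {s : ℝ} (h : s ≤ R / 32) : shearRadial R s = 0 := by
  rw [shearRadial, rampCutoff_of_le (by linarith) h, zero_mul]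

/-- [folklore] -/
theorem shearRadial_eq_zero_of_ge (hR : 0 < R) {s : ℝ} (h : 3 * R ≤ s) : shearRadial R s = 0 := by
  rw [shearRadial, rampCutoff_of_ge (by linarith) h, sub_self, mul_zero]

/-- [folklore] -/
theorem shearRadial_mem_Icc (R s : ℝ) : shearRadial R s ∈ Icc (0 : ℝ) 1 := by
  have h1 := rampCutoff_mem_Icc (R / 32) (R / 16) s
  have h2 := rampCutoff_mem_Icc (2 * R) (3 * R) s
  constructor <;> · rw [shearRadial]; nlinarith [h1.1, h1.2, h2.1, h2.2]

/-- [folklore] -/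
theorem shearAngular_eq_one (hθ : 0 < θ₀) {ρ : ℝ} (h : ρ ≤ θ₀ ^ 2) : shearAngular θ₀ ρ = 1 := by
  rw [shearAngular, rampCutoff_of_le (by nlinarith) h, sub_zero]

/-- [folklore] -/
theorem shearAngular_eq_zero (hθ : 0 < θ₀) {ρ : ℝ} (h : 4 * θ₀ ^ 2 ≤ ρ) : shearAngular θ₀ ρ = 0 := by
  rw [shearAngular, rampCutoff_of_ge (by nlinarith) h, sub_self]

/-- [folklore] -/
theorem shearAngular_mem_Icc (θ₀ ρ : ℝ) : shearAngular θ₀ ρ ∈ Icc (0 : ℝ) 1 := by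
  have h := rampCutoff_mem_Icc (θ₀ ^ 2) (4 * θ₀ ^ 2) ρ
  rw [shearAngular]; constructor <;> linarith [h.1, h.2]

/-- The shear weight takes values in `[0, 1]`. [folklore] -/
theorem shearWeight_mem_Icc (i : Fin m) (z : H) : shearWeight v R θ₀ i z ∈ Icc (0 : ℝ) 1 := by
  have h1 := shearRadial_mem_Icc R (shearAxial v i z)
  have h2 := shearAngular_mem_Icc θ₀ (‖shearTrans v i z‖ ^ 2 / shearAxial v i z ^ 2)
  rw [shearWeight]
  exact ⟨mul_nonneg h1.1 h2.1, mul_le_one₀ h1.2 h2.1 h2.2⟩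

/-! ### Values on the axes and near the origin -/

/-- On its own axis the `i`-th weight is `1` for `s ∈ [R/16, 2R]` (unit `v i`, `θ₀ > 0`). [folklore] -/
theorem shearWeight_axis_self (hR : 0 < R) (hθ : 0 < θ₀) {i : Fin m} (hv : ‖v i‖ = 1) {s : ℝ} (h₁ : R / 16 ≤ s)
    (h₂ : s ≤ 2 * R) : shearWeight v R θ₀ i (s • v i) = 1 := by
  have hax : shearAxial v i (s • v i) = s := by
    rw [shearAxial, inner_smul_right, real_inner_self_eq_norm_sq, hv]; ring
  have htr : shearTrans v i (s • v i) = 0 := by rw [shearTrans, hax, sub_self]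
  rw [shearWeight, hax, htr, norm_zero, shearRadial_eq_one hR h₁ h₂, one_mul]
  refine shearAngular_eq_one hθ ?_
  rw [zero_pow two_ne_zero, zero_div]; positivity

/-- On the `i`-th axis every other weight vanishes, provided the directions are separated:
`⟪v j, v i⟫ ^ 2 * (1 + 4 θ₀²) ≤ 1` (then the axis of `i` has squared slope `≥ 4θ₀²` in the cone of
`j`, or negative axial coordinate). [folklore] -/
theorem shearWeight_axis_other (hR : 0 < R) (hθ : 0 < θ₀) {i j : Fin m} (hvi : ‖v i‖ = 1) (hvj : ‖v j‖ = 1)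
    (hsep : ⟪v j, v i⟫ ^ 2 * (1 + 4 * θ₀ ^ 2) ≤ 1) {s : ℝ} (hs : 0 < s) :
    shearWeight v R θ₀ j (s • v i) = 0 := by
  set c : ℝ := ⟪v j, v i⟫ with hc
  have hax : shearAxial v j (s • v i) = s * c := by rw [shearAxial, inner_smul_right]
  -- transverse part and its squared norm: `s² (1 − c²)`
  have htr : ‖shearTrans v j (s • v i)‖ ^ 2 = s ^ 2 * (1 - c ^ 2) := by
    rw [shearTrans, hax, ← real_inner_self_eq_norm_sq]
    have h1 : ⟪v i, v i⟫ = 1 := by rw [real_inner_self_eq_norm_sq, hvi, one_pow]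
    have h2 : ⟪v j, v j⟫ = 1 := by rw [real_inner_self_eq_norm_sq, hvj, one_pow]
    have h3 : ⟪v i, v j⟫ = c := by rw [hc, real_inner_comm]
    simp only [inner_sub_left, inner_sub_right, inner_smul_left, inner_smul_right, h1, h2, h3, ← hc,
      RCLike.conj_to_real]
    ring
  rw [shearWeight]
  by_cases hc0 : s * c ≤ R / 32
  · rw [hax, shearRadial_eq_zero_of_le hR hc0, zero_mul]
  · -- positive axial coordinate: the angular cutoff vanishes
    have hcpos : 0 < c := by
      by_contra hneg
      rw [not_lt] at hneg
      have : s * c ≤ 0 := mul_nonpos_of_nonneg_of_nonpos hs.le hneg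
      exact hc0 (this.trans (by linarith))
    rw [hax, htr]
    have hratio : 4 * θ₀ ^ 2 ≤ s ^ 2 * (1 - c ^ 2) / (s * c) ^ 2 := by
      rw [le_div_iff₀ (by positivity)]
      have : c ^ 2 * (1 + 4 * θ₀ ^ 2) ≤ 1 := hsep
      nlinarith [sq_nonneg s, hs]
    rw [shearAngular_eq_zero hθ hratio, mul_zero]

/-- **The shear maps the tangent segment onto the curve**: `vertexShear γ v R θ₀ (s • v i) = γ i s`
for `s ∈ [R/16, 2R]`, when all directions are unit and pairwise separated. [folklore] -/
theorem vertexShear_apply_axis (hR : 0 < R) (hθ : 0 < θ₀) (hv : ∀ i, ‖v i‖ = 1)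
    (hsep : ∀ i j, i ≠ j → ⟪v j, v i⟫ ^ 2 * (1 + 4 * θ₀ ^ 2) ≤ 1) (i : Fin m) {s : ℝ}
    (h₁ : R / 16 ≤ s) (h₂ : s ≤ 2 * R) : vertexShear γ v R θ₀ (s • v i) = γ i s := by
  have hs : 0 < s := lt_of_lt_of_le (by linarith) h₁
  have hax : shearAxial v i (s • v i) = s := by
    rw [shearAxial, inner_smul_right, real_inner_self_eq_norm_sq, hv i]; ring
  rw [vertexShear, Finset.sum_eq_single i]
  · rw [shearWeight_axis_self hR hθ (hv i) h₁ h₂, one_smul, shearDisp, hax, add_sub_cancel]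
  · intro j _ hji
    rw [shearWeight_axis_other hR hθ (hv i) (hv j) (hsep i j hji.symm) hs, zero_smul]
  · intro h
    exact (h (Finset.mem_univ i)).elim

/-- **Near the origin the shear is the identity**: if `‖z‖ ≤ R/32` all weights vanish (the axial
coordinate is at most `‖z‖`). [folklore] -/
theorem vertexShear_eq_self_of_norm_le (hR : 0 < R) (hv : ∀ i, ‖v i‖ = 1) {z : H} (hz : ‖z‖ ≤ R / 32) :
    vertexShear γ v R θ₀ z = z := by
  rw [vertexShear, add_eq_left]
  refine Finset.sum_eq_zero fun i _ => ?_
  have hax : shearAxial v i z ≤ R / 32 := by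
    have h := abs_real_inner_le_norm (v i) z
    rw [hv i, one_mul] at h
    exact (le_abs_self _).trans (h.trans hz)
  rw [shearWeight, shearRadial_eq_zero_of_le hR hax, zero_mul, zero_smul]

/-- Wherever all weights vanish the shear is the identity. [folklore] -/
theorem vertexShear_eq_self_of_weight_eq_zero {z : H} (h : ∀ i, shearWeight v R θ₀ i z = 0) :
    vertexShear γ v R θ₀ z = z := by
  rw [vertexShear, add_eq_left]
  exact Finset.sum_eq_zero fun i _ => by rw [h i, zero_smul]

/-- **Far from the origin the shear is the identity**: for `‖z‖ … ` — if the axial coordinate of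
`z` along `v i` is `≥ 3R` the `i`-th weight vanishes; if it is in `(R/32, 3R)` but the transverse
part has squared slope `≥ 4θ₀²`, it vanishes too. In particular the shear is the identity off the
ball of radius `3R √(1 + 4θ₀²)`. [folklore] -/
theorem shearWeight_eq_zero_of_norm_ge (hR : 0 < R) (hθ : 0 < θ₀) {i : Fin m} (hv : ‖v i‖ = 1) {z : H}
    (hz : 3 * R * Real.sqrt (1 + 4 * θ₀ ^ 2) ≤ ‖z‖) : shearWeight v R θ₀ i z = 0 := by
  set s : ℝ := shearAxial v i z with hs
  set w : H := shearTrans v i z with hw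
  rw [shearWeight]
  by_cases h3 : 3 * R ≤ s
  · rw [shearRadial_eq_zero_of_ge hR h3, zero_mul]
  · by_cases h0 : s ≤ R / 32
    · rw [shearRadial_eq_zero_of_le hR h0, zero_mul]
    · -- `R/32 < s < 3R`: the slope is large
      rw [not_le] at h3 h0
      have hspos : 0 < s := lt_trans (by linarith) h0
      -- `‖z‖² = s² + ‖w‖²`
      have hpy : ‖z‖ ^ 2 = s ^ 2 + ‖w‖ ^ 2 := by
        have hzw : z = s • v i + w := by rw [hw, shearTrans, ← hs, add_sub_cancel]
        have hviw : ⟪v i, w⟫ = 0 := by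
          rw [hw, shearTrans, ← hs, inner_sub_right, inner_smul_right, real_inner_self_eq_norm_sq, hv,
            one_pow, mul_one, hs, shearAxial, sub_self]
        have horth : ⟪s • v i, w⟫ = 0 := by rw [real_inner_smul_left, hviw, mul_zero]
        have h := norm_add_sq_eq_norm_sq_add_norm_sq_of_inner_eq_zero _ _ horth
        rw [← hzw, norm_smul, Real.norm_eq_abs, hv, mul_one] at h
        calc ‖z‖ ^ 2 = ‖z‖ * ‖z‖ := pow_two _
          _ = |s| * |s| + ‖w‖ * ‖w‖ := h
          _ = s ^ 2 + ‖w‖ ^ 2 := by rw [← pow_two, ← pow_two, sq_abs]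
      have hslope : 4 * θ₀ ^ 2 ≤ ‖w‖ ^ 2 / s ^ 2 := by
        rw [le_div_iff₀ (by positivity)]
        have h1 : (3 * R * Real.sqrt (1 + 4 * θ₀ ^ 2)) ^ 2 ≤ ‖z‖ ^ 2 :=
          pow_le_pow_left₀ (by positivity) hz 2
        rw [mul_pow, Real.sq_sqrt (by positivity)] at h1
        have e : (3 * R) ^ 2 * (1 + 4 * θ₀ ^ 2) = 9 * R ^ 2 + 36 * (R ^ 2 * θ₀ ^ 2) := by ring
        rw [e, hpy] at h1
        have hs9 : s ^ 2 < 9 * R ^ 2 := by nlinarith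
        have h4 : 4 * θ₀ ^ 2 * s ^ 2 ≤ 36 * (R ^ 2 * θ₀ ^ 2) := by
          nlinarith [mul_le_mul_of_nonneg_left hs9.le (by positivity : (0 : ℝ) ≤ 4 * θ₀ ^ 2)]
        linarith
      rw [shearAngular_eq_zero hθ hslope, mul_zero]

/-! ### Smoothness -/

/-- The axial coordinate is smooth (linear). [folklore] -/
theorem contDiff_shearAxial (v : Fin m → H) (i : Fin m) : ContDiff ℝ ∞ (shearAxial v i) :=
  (innerSL ℝ (v i)).contDiff

/-- The transverse part is smooth. [folklore] -/
theorem contDiff_shearTrans (v : Fin m → H) (i : Fin m) : ContDiff ℝ ∞ (shearTrans v i) :=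
  contDiff_id.sub ((contDiff_shearAxial v i).smul contDiff_const)

/-- The displacement is smooth if the curve is. [folklore] -/
theorem contDiff_shearDisp {i : Fin m} (hγ : ContDiff ℝ ∞ (γ i)) : ContDiff ℝ ∞ (shearDisp γ v i) :=
  (hγ.comp (contDiff_shearAxial v i)).sub ((contDiff_shearAxial v i).smul contDiff_const)

/-- The radial plateau is smooth. [folklore] -/
theorem contDiff_shearRadial (R : ℝ) : ContDiff ℝ ∞ (shearRadial R) :=
  (contDiff_rampCutoff _ _).mul (contDiff_const.sub (contDiff_rampCutoff _ _))

/-- The angular cutoff is smooth. [folklore] -/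
theorem contDiff_shearAngular (θ₀ : ℝ) : ContDiff ℝ ∞ (shearAngular θ₀) :=
  contDiff_const.sub (contDiff_rampCutoff _ _)

/-- **The shear weight is smooth** (`R > 0`): near a point with axial coordinate `< R/32`, hence in
particular wherever the axial coordinate vanishes and the slope is singular, the radial factor is
identically zero; elsewhere the slope is a smooth function. [folklore] -/
theorem contDiff_shearWeight (hR : 0 < R) (i : Fin m) : ContDiff ℝ ∞ (shearWeight v R θ₀ i) := by
  refine contDiff_iff_contDiffAt.2 fun z => ?_
  by_cases hs : shearAxial v i z < R / 32
  · -- locally zero radial factor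
    have hev : shearWeight v R θ₀ i =ᶠ[𝓝 z] fun _ => 0 := by
      have ho : IsOpen {q : H | shearAxial v i q < R / 32} :=
        isOpen_lt (contDiff_shearAxial v i).continuous continuous_const
      filter_upwards [ho.mem_nhds hs] with q hq
      rw [shearWeight, shearRadial_eq_zero_of_le hR (le_of_lt hq), zero_mul]
    exact contDiffAt_const.congr_of_eventuallyEq hev
  · have hs0 : shearAxial v i z ≠ 0 := by intro h; rw [h] at hs; exact hs (by linarith)
    have h1 : ContDiffAt ℝ ∞ (fun q => shearRadial R (shearAxial v i q)) z :=
      (contDiff_shearRadial R).contDiffAt.comp z (contDiff_shearAxial v i).contDiffAt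
    have h2 : ContDiffAt ℝ ∞ (fun q => ‖shearTrans v i q‖ ^ 2 / shearAxial v i q ^ 2) z :=
      ((contDiff_shearTrans v i).contDiffAt.norm_sq ℝ).div
        ((contDiff_shearAxial v i).contDiffAt.pow 2) (pow_ne_zero 2 hs0)
    exact h1.mul ((contDiff_shearAngular θ₀).contDiffAt.comp z h2)

/-- **The vertex shear is smooth.** [folklore] -/
theorem contDiff_vertexShear (hR : 0 < R) (hγ : ∀ i, ContDiff ℝ ∞ (γ i)) :
    ContDiff ℝ ∞ (vertexShear γ v R θ₀) := by
  unfold vertexShear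
  refine contDiff_id.add (ContDiff.sum fun i _ => ?_)
  exact (contDiff_shearWeight hR i).smul (contDiff_shearDisp (hγ i))

end Literature.Topology.FourManifolds
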